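import Mathlib.Analysis.InnerProductSpace.PiL2
import Mathlib.Analysis.SpecialFunctions.Trigonometric.Basic
import Literature.MathematicalPhysics.StatisticalMechanics.StickyWulffConstants
import HarnessLib

/-!
# Line `WallLedgerF` for the crux `CoaxialWallLaw` (stmt-Ventures-19481) — DEFINITIONS file

HONEST FRAMING. Part of the venture `Summits/Ventures/Crystal3D` (cell `crystal3d-full`), route
`route-Ventures-StickyWulffConstant`, crux `CoaxialWallLaw` (stmt-Ventures-19481).  This file carries,
VERBATIM, the two `Prop` definitions of the planner's REGISTERED skeleton
`HOME/cf-p1/route/lines/wall/WallLedgerF.lean` (planner crystal3d-full-p1 gen 16; `ledger skeleton check` OK,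
skeleton sha 3baec21f…; evidence on stmt-Ventures-19481) so that the registered stubs
`stub_affineSampleDeficit : AffineSampleDeficit` and `stub_coaxialTwoSlabAdhesion : CoaxialTwoSlabAdhesion` can be
proved BY NAME in `Theorems/` files against exactly these names (the sibling line `WallLedgerG` of the crux
`GenericWallFloor` did the same in `…GenericWallFloorWallLedgerGDefs`).  Imports are route-independent (no
`Theses` import); declarations unchanged.

The clamped-cylinder wall cell of `CoaxialWallLaw` is split exactly like the NRG line `adhesion` and the line
`WallLedgerG`:

  `D(X) = D(P₁) + D(P₂) + D(Y) − cross(P₁, X \ P₁) − cross(P₂, (X \ P₁) \ P₂)`,  `Y = (X \ P₁) \ P₂`,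

so the crux follows from

* `AffineSampleDeficit` (S/M; the SAME statement as `WallLedgerG.AffineSampleDeficit`, proved there as
  `Theorems.stub_affineSampleDeficit`): the sample's own deficiency counts its two flat faces;
* `CoaxialTwoSlabAdhesion` (THE CRUX OF THE LINE): for a CO-AXIAL pair of DISTINCT lattices, for SOME shared Barlow
  frame `L`, the filling's adhesion to the two clamped samples exceeds its own deficiency by at most
  `(φ₁ + φ₂ − ½ sin∠(e₃, L e₃)) π ρ² + C (1 + h) ρ` (terrace/riser ledger; memo HOME/cf-p1/ROUTE.md §68).

The kernel-checked composition `CoaxialWallLaw_holds_of_stubs` stays in the planner's skeleton (it imports the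
route file); it is landed as the closing file once both stubs are in the tree.
WHAT THIS IS NOT: a proof of either stub; rung F-C1 not moved.
-/

noncomputable section

namespace Summit.Ventures.Crystal3D.Cruxes.CoaxialWallLaw.WallLedgerF

open Literature.MathematicalPhysics.StatisticalMechanics (fccStacking barlowStacking IsHaggSeq
  contactDeficiency)
open scoped InnerProductSpace

/-- **stub_affineSampleDeficit** (S/M): the clamped slab sample of a MOVED fcc lattice `A·Λ₀ + t`
(height window `[a, b]` of thickness `b − a = R ≥ 1`, lateral disc of radius `ρ` about the `e₃`
axis) has contact deficiency at least its two flat faces, `2 φ(A⁻¹ e₃) π ρ² − C ρ`, with `C`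
depending on `A, t, R` only.  Transport of `Theorems.stub_sampleDeficit` (landed, origin-centred,
window `[−2R, −R]`, arbitrary unit normal) through the rigid motion, plus the off-centre disc. -/
def AffineSampleDeficit : Prop :=
    ∀ (A : EuclideanSpace ℝ (Fin 3) ≃ₗᵢ[ℝ] EuclideanSpace ℝ (Fin 3)) (t : EuclideanSpace ℝ (Fin 3))
      (R : ℝ), 1 ≤ R → ∃ C : ℝ, ∀ a b : ℝ, b - a = R → ∀ ρ : ℝ, R ≤ ρ →
      ∀ P : Finset (EuclideanSpace ℝ (Fin 3)),
        (∀ p, p ∈ P ↔ (p ∈ (fun q => A q + t) '' fccStacking 1 (Real.sqrt (2 / 3)) ∧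
          a ≤ p 2 ∧ p 2 ≤ b ∧ p 0 ^ 2 + p 1 ^ 2 ≤ ρ ^ 2)) →
        2 * (Real.sqrt 2 / 4 * ∑ᶠ w ∈ {w ∈ fccStacking 1 (Real.sqrt (2 / 3)) | ‖w‖ = 1},
            |⟪w, A.symm (EuclideanSpace.single (2 : Fin 3) (1 : ℝ))⟫_ℝ|) * Real.pi * ρ ^ 2 - C * ρ ≤
          contactDeficiency P

/-- **stub_coaxialTwoSlabAdhesion** (THE CRUX OF THE LINE): for a CO-AXIAL pair of DISTINCT fcc
lattices `Λ₁ = A₁·Λ₀ + t₁ ≠ Λ₂ = A₂·Λ₀ + t₂` there are a shared Barlow frame `L` (with its data)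
and `C`, `R₀ ≥ 1` such that in every clamped
cylinder cell (all balls in `[−2R₀, h + 2R₀] ×` disc `ρ`, the two slab samples `P₁ ⊆ Λ₁`
(`[−2R₀, −R₀]`) and `P₂ ⊆ Λ₂` (`[h + R₀, h + 2R₀]`) complete), the ADHESION EXCESS of the filling
`Y = (X \ P₁) \ P₂` is at most the two inner faces minus HALF THE SINE of the wall inclination to the shared axis:
`cross(P₁, X \ P₁) + cross(P₂, Y) ≤ D(Y) + (φ₁ + φ₂ − ½ √(1 − ⟪L e₃, e₃⟫²)) π ρ² + C (1 + h) ρ`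
(`φᵢ = φ(Aᵢ⁻¹ e₃)` inlined).  Ledger reading: unconsumed slots + interlayer deficiency
`≥ sin∠(e₃, L e₃) · π ρ² − C(1+h)ρ`; zero for the basal (coherent) inclination. -/
def CoaxialTwoSlabAdhesion : Prop :=
    ∀ (A₁ : EuclideanSpace ℝ (Fin 3) ≃ₗᵢ[ℝ] EuclideanSpace ℝ (Fin 3)) (t₁ : EuclideanSpace ℝ (Fin 3))
      (A₂ : EuclideanSpace ℝ (Fin 3) ≃ₗᵢ[ℝ] EuclideanSpace ℝ (Fin 3)) (t₂ : EuclideanSpace ℝ (Fin 3)),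
    (∃ (L : EuclideanSpace ℝ (Fin 3) ≃ₗᵢ[ℝ] EuclideanSpace ℝ (Fin 3))
        (s₁ s₂ : EuclideanSpace ℝ (Fin 3)) (σ σ' : ℤ → ℤ), IsHaggSeq σ ∧ IsHaggSeq σ' ∧
        (fun p => A₁ p + t₁) '' fccStacking 1 (Real.sqrt (2 / 3)) ⊆
          (fun p => L p + s₁) '' barlowStacking 1 (Real.sqrt (2 / 3)) σ ∧
        (fun p => A₂ p + t₂) '' fccStacking 1 (Real.sqrt (2 / 3)) ⊆
          (fun p => L p + s₂) '' barlowStacking 1 (Real.sqrt (2 / 3)) σ') →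
    (fun p => A₁ p + t₁) '' fccStacking 1 (Real.sqrt (2 / 3)) ≠
      (fun p => A₂ p + t₂) '' fccStacking 1 (Real.sqrt (2 / 3)) →
    ∃ (L : EuclideanSpace ℝ (Fin 3) ≃ₗᵢ[ℝ] EuclideanSpace ℝ (Fin 3))
        (s₁ s₂ : EuclideanSpace ℝ (Fin 3)) (σ σ' : ℤ → ℤ), IsHaggSeq σ ∧ IsHaggSeq σ' ∧
        (fun p => A₁ p + t₁) '' fccStacking 1 (Real.sqrt (2 / 3)) ⊆
          (fun p => L p + s₁) '' barlowStacking 1 (Real.sqrt (2 / 3)) σ ∧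
        (fun p => A₂ p + t₂) '' fccStacking 1 (Real.sqrt (2 / 3)) ⊆
          (fun p => L p + s₂) '' barlowStacking 1 (Real.sqrt (2 / 3)) σ' ∧
    ∃ C R₀ : ℝ, 1 ≤ R₀ ∧ ∀ h : ℝ, 0 ≤ h → ∀ ρ : ℝ, R₀ ≤ ρ →
      ∀ X P₁ P₂ : Finset (EuclideanSpace ℝ (Fin 3)),
      (∀ p ∈ X, ∀ q ∈ X, p ≠ q → 1 ≤ dist p q) → P₁ ⊆ X → P₂ ⊆ X \ P₁ →
      (∀ p ∈ X, -(2 * R₀) ≤ p 2 ∧ p 2 ≤ h + 2 * R₀ ∧ p 0 ^ 2 + p 1 ^ 2 ≤ ρ ^ 2) →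
      (∀ p, p ∈ P₁ ↔ (p ∈ (fun q => A₁ q + t₁) '' fccStacking 1 (Real.sqrt (2 / 3)) ∧
        -(2 * R₀) ≤ p 2 ∧ p 2 ≤ -R₀ ∧ p 0 ^ 2 + p 1 ^ 2 ≤ ρ ^ 2)) →
      (∀ p, p ∈ P₂ ↔ (p ∈ (fun q => A₂ q + t₂) '' fccStacking 1 (Real.sqrt (2 / 3)) ∧
        h + R₀ ≤ p 2 ∧ p 2 ≤ h + 2 * R₀ ∧ p 0 ^ 2 + p 1 ^ 2 ≤ ρ ^ 2)) →
      ((((P₁ ×ˢ (X \ P₁)).filter fun pq => dist pq.1 pq.2 = 1).card : ℕ) : ℝ) +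
        ((((P₂ ×ˢ ((X \ P₁) \ P₂)).filter fun pq => dist pq.1 pq.2 = 1).card : ℕ) : ℝ) ≤
        contactDeficiency ((X \ P₁) \ P₂) +
          (Real.sqrt 2 / 4 * ∑ᶠ w ∈ {w ∈ fccStacking 1 (Real.sqrt (2 / 3)) | ‖w‖ = 1},
              |⟪w, A₁.symm (EuclideanSpace.single (2 : Fin 3) (1 : ℝ))⟫_ℝ| +
            Real.sqrt 2 / 4 * ∑ᶠ w ∈ {w ∈ fccStacking 1 (Real.sqrt (2 / 3)) | ‖w‖ = 1},
              |⟪w, A₂.symm (EuclideanSpace.single (2 : Fin 3) (1 : ℝ))⟫_ℝ| -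
            (1 / 2 : ℝ) * Real.sqrt (1 - ⟪L (EuclideanSpace.single (2 : Fin 3) (1 : ℝ)),
              (EuclideanSpace.single (2 : Fin 3) (1 : ℝ))⟫_ℝ ^ 2)) * Real.pi * ρ ^ 2 +
          C * (1 + h) * ρ

end Summit.Ventures.Crystal3D.Cruxes.CoaxialWallLaw.WallLedgerF

end
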